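import Literature.AlgebraicGeometry.Motives.MixedHodgeStructureDual
import Literature.AlgebraicGeometry.Motives.MixedHodgeStructureDeligneIDimension
import HarnessLib

/-!
# Hodge numbers of the dual of a (mixed) Hodge structure: `h^{p,q}(H^∨) = h^{-p,-q}(H)`

For a pure `ℚ`-Hodge structure `A` of weight `n` the dual `A^∨` (weight `-n`; the tree's
`HodgeStructure.dual`, `Motives/HodgeTensor.lean`, filtration `F^p(A^∨) = (F^{1-p} A)^⊥` of Deligne,
*Hodge II*, 1.1.6–1.1.7) has Hodge pieces
`(A^∨)^{-p,-q} = {f : A → ℂ | f|A^{r,s} = 0, (r,s) ≠ (p,q)}` (Carlson–Müller-Stach–Peters, §1.2), so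
`h^{p,q}(A^∨) = h^{-p,-q}(A)`.  For a mixed Hodge structure `H` the dual MHS `H^∨`
(`MixedHodgeStructure.dual`, `Motives/MixedHodgeStructureDual.lean`; `W_r(H^∨) = (W_{-r-1} H)^⊥`,
`F^p(H^∨) = (F^{1-p} H)^⊥`: Fujiki 1980 (1.6.2) a), Cattani–El Zein–Griffiths–Lê §3.2.2.7) has
`Gr^W_r(H^∨) = (Gr^W_{-r} H)^∨` (El Zein 1983, §II.0.2: "`Gr^W_r H = Hom(Gr^W_{-r} K, K')`" for the
dual filtration on `Hom(K, K')`, `K'` with trivial filtration), whence again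
`h^{p,q}(H^∨) = h^{-p,-q}(H)` for the Hodge numbers of an MHS
(`h^{p,q}(H) = h^{p,q}(Gr^W_{p+q} H)`, Cattani et al. §3.2.2.6).

Everything is PROVED, by counting dimensions inside the lattices of subspaces of `V_ℂ` and of
`(V_ℂ)^∨ ≅ ℂ ⊗ V^∨` (annihilator duality `U ↦ U^⊥`, `dim U + dim U^⊥ = dim V`):

* `HodgeStructure.hodgeNumber_add_finrank_F_succ_sup` — for `A` pure of weight `n = a + b`,
  `h^{a,b}(A) + dim (F^{a+1} + conj F^{b+1}) = dim A` (the complement of `F^{a+1} ⊕ conj F^{b+1}` in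
  `A_ℂ = ⊕ A^{r,s}` is `A^{a,b}`; here from the two opposedness identities
  `F^{a+1} ⊕ conj F^{b} = A_ℂ = F^{a} ⊕ conj F^{b+1}` alone);
* `HodgeStructure.dual_piece` — `(A^∨)^{p,q} = (F^{1-p} A + conj F^{1-q} A)^⊥`, and
  **`HodgeStructure.hodgeNumber_dual`** — `h^{p,q}(A^∨) = h^{-p,-q}(A)`;
* `MixedHodgeStructure.dual_hodgePreimage` — the preimage in `(V_ℂ)^∨` of the Hodge piece
  `(Gr^W_{p+q} H^∨)^{p,q}` is the annihilator of the preimage in `V_ℂ` of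
  `F^{1-p} Gr^W_{-p-q} H + conj F^{1-q} Gr^W_{-p-q} H`;
* **`MixedHodgeStructure.hodgeNumber_dual`** — `h^{p,q}(H^∨) = h^{-p,-q}(H)` for every MHS `H` on a
  finite-dimensional `V`;
* `MixedHodgeStructure.finrank_dual_W_add`, `isWeight_dual_iff` (`k` is a weight of `H^∨` iff `-k`
  is a weight of `H`), `isPure_dual_iff` (`H^∨` is pure of weight `-n` iff `H` is pure of weight `n`).

## References

* [CarlsonMullerStachPeters2017] J. Carlson, S. Müller-Stach, C. Peters, *Period Mappings and Period
  Domains*, 2nd ed. (2017), §1.2 (the dual Hodge structure, `(A^∨)^{-p,-q}`; Problem 1.2.7).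
* [Fujiki1980] A. Fujiki, Duality of mixed Hodge structures of algebraic varieties, Publ. RIMS 16
  (1980), (1.6.2) a) (the dual MHS: `W'_i = (W_{-i-1})^⊥`, `F'^p = (F^{1-p})^⊥`).
* [Elzein1983] F. El Zein, Mixed Hodge structures, Trans. AMS 275 (1983), §II.0 (dual filtrations;
  `Gr^W_r Hom(K, K') ≅ Hom(Gr^W_{-r} K, K')`).
* [CattaniElZeinGriffithsLe2014] E. Cattani et al. (eds.), *Hodge Theory* (2014), §3.2.2.6 (Hodge
  numbers of an MHS), §3.2.2.7 (the dual MHS).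
* [DeligneHodgeII1971] P. Deligne, Théorie de Hodge II, 1.1.6–1.1.7 (filtrations on duals).
-/

noncomputable section

open scoped TensorProduct

namespace Literature.AlgebraicGeometry.Motives

universe u

variable {V : Type u} [AddCommGroup V] [Module ℚ V]

open Module
open HodgeStructure (conj complexConj complexConj_mono complexConj_sup complexConj_inf dualBaseChange
  dualBaseChange_bijective dualBaseChange_injective complexConj_dualFiltration)

/-! ### Annihilators pulled back along `ℂ ⊗ V^∨ ≅ (ℂ ⊗ V)^∨` -/

namespace HodgeStructure

/-- Pulling back along the bijection `dualBaseChange V : ℂ ⊗ V^∨ → (ℂ ⊗ V)^∨` (`V` finite-dimensional)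
preserves dimensions. [folklore] -/
private theorem finrank_comap_dualBaseChange [FiniteDimensional ℚ V]
    (U : Submodule ℂ (Module.Dual ℂ (ℂ ⊗[ℚ] V))) :
    finrank ℂ (U.comap (dualBaseChange V)) = finrank ℂ U := by
  let e : (ℂ ⊗[ℚ] Module.Dual ℚ V) ≃ₗ[ℂ] Module.Dual ℂ (ℂ ⊗[ℚ] V) :=
    LinearEquiv.ofBijective (dualBaseChange V) dualBaseChange_bijective
  have h : U.comap (dualBaseChange V) = U.map (e.symm : _ →ₗ[ℂ] _) := by
    rw [← Submodule.comap_equiv_eq_map_symm]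
    rfl
  rw [h, LinearEquiv.finrank_map_eq]

/-- Pulling back along the bijection `dualBaseChange V` preserves binary suprema. [folklore] -/
private theorem comap_dualBaseChange_sup [FiniteDimensional ℚ V]
    (X Y : Submodule ℂ (Module.Dual ℂ (ℂ ⊗[ℚ] V))) :
    (X ⊔ Y).comap (dualBaseChange V) = X.comap (dualBaseChange V) ⊔ Y.comap (dualBaseChange V) := by
  have hr : LinearMap.range (dualBaseChange V) = ⊤ := LinearMap.range_eq_top.2 dualBaseChange_bijective.2
  exact Submodule.comap_sup_of_injective dualBaseChange_injective (hr ▸ le_top) (hr ▸ le_top)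

end HodgeStructure

/-! ### The pure case: `h^{p,q}(A^∨) = h^{-p,-q}(A)` -/

namespace HodgeStructure

variable {n : ℤ}

/-- **`h^{a,b}(A) + dim_ℂ (F^{a+1} + conj F^{b+1}) = dim A`** for a pure Hodge structure `A` of weight
`n = a + b` on a finite-dimensional `V`: in the Hodge decomposition `A_ℂ = ⊕ A^{r,s}`,
`F^{a+1} = ⊕_{r > a} A^{r,s}` and `conj F^{b+1} = ⊕_{r < a} A^{r,s}`, with complement `A^{a,b}`
(Carlson–Müller-Stach–Peters §1.2).  Proved from the two opposedness identities
`F^{a+1} ⊕ conj F^{b} = A_ℂ = F^{a} ⊕ conj F^{b+1}` (`isCompl_F_complexConj`) and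
`A^{a,b} = F^a ∩ conj F^b`, by `dim (X + Y) + dim (X ∩ Y) = dim X + dim Y`.
[cite: CarlsonMullerStachPeters2017, §1.2] -/
theorem hodgeNumber_add_finrank_F_succ_sup [FiniteDimensional ℚ V] (H : HodgeStructure V n) {a b : ℤ}
    (hab : a + b = n) :
    H.hodgeNumber a b + finrank ℂ ↥(H.F (a + 1) ⊔ complexConj (H.F (b + 1))) = finrank ℚ V := by
  have h1 := H.isCompl_F_complexConj (a + 1) b (by omega)
  have h2 := H.isCompl_F_complexConj a (b + 1) (by omega)
  have e1 := Submodule.finrank_sup_add_finrank_inf_eq (H.F (a + 1)) (complexConj (H.F b))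
  rw [h1.sup_eq_top, h1.inf_eq_bot, finrank_bot, add_zero, finrank_top, Module.finrank_baseChange] at e1
  have e2 := Submodule.finrank_sup_add_finrank_inf_eq (H.F a) (complexConj (H.F (b + 1)))
  rw [h2.sup_eq_top, h2.inf_eq_bot, finrank_bot, add_zero, finrank_top, Module.finrank_baseChange] at e2
  have htop : H.F a ⊔ complexConj (H.F b) = ⊤ :=
    eq_top_iff.2 (h2.sup_eq_top.ge.trans
      (sup_le_sup_left (complexConj_mono (H.antitone_F (show b ≤ b + 1 by omega))) _))
  have e3 := Submodule.finrank_sup_add_finrank_inf_eq (H.F a) (complexConj (H.F b))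
  rw [htop, finrank_top, Module.finrank_baseChange] at e3
  have hbot : H.F (a + 1) ⊓ complexConj (H.F (b + 1)) = ⊥ :=
    eq_bot_iff.2 ((inf_le_inf_left _ (complexConj_mono (H.antitone_F (show b ≤ b + 1 by omega)))).trans
      h1.inf_eq_bot.le)
  have e4 := Submodule.finrank_sup_add_finrank_inf_eq (H.F (a + 1)) (complexConj (H.F (b + 1)))
  rw [hbot, finrank_bot, add_zero] at e4
  rw [hodgeNumber, piece_of_add_eq H hab]
  omega

/-- **The Hodge pieces of the dual**: `(A^∨)^{p,q} = (F^{1-p} A + conj F^{1-q} A)^⊥` for `p + q = -n`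
(pulled back along `ℂ ⊗ V^∨ ≅ (ℂ ⊗ V)^∨`): a form lies in `F^p(A^∨) ∩ conj F^q(A^∨)` iff it kills
`F^{1-p}` and `conj F^{1-q}`, i.e. all `A^{r,s}` with `(r, s) ≠ (-p, -q)` — Carlson–Müller-Stach–Peters,
§1.2: "`(A^∨)^{-p,-q} = {f : A → ℂ | f|A^{r,s} = 0, (r,s) ≠ (p,q)}`".
[cite: CarlsonMullerStachPeters2017, §1.2] -/
theorem dual_piece [HodgeTensorFacts.{u, u}] [FiniteDimensional ℚ V] (H : HodgeStructure V n) {p q : ℤ}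
    (hpq : p + q = -n) :
    H.dual.piece p q =
      ((H.F (1 - p) ⊔ complexConj (H.F (1 - q))).dualAnnihilator).comap (dualBaseChange V) := by
  rw [piece_of_add_eq _ hpq, dual_F, dual_F, complexConj_dualFiltration, dualFiltration,
    ← Submodule.comap_inf, ← Submodule.dualAnnihilator_sup_eq]

/-- **Hodge numbers of the dual Hodge structure: `h^{p,q}(A^∨) = h^{-p,-q}(A)`** for a pure Hodge
structure `A` of weight `n` on a finite-dimensional `V` (`A^∨` of weight `-n`): the Hodge pieces of
`A^∨` are `(A^∨)^{-p,-q} = (⊕_{(r,s) ≠ (p,q)} A^{r,s})^⊥ ≅ (A^{p,q})^∨` (Carlson–Müller-Stach–Peters, §1.2).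
Off the line `p + q = -n` both sides vanish. [cite: CarlsonMullerStachPeters2017, §1.2] -/
theorem hodgeNumber_dual [HodgeTensorFacts.{u, u}] [FiniteDimensional ℚ V] (H : HodgeStructure V n)
    (p q : ℤ) : H.dual.hodgeNumber p q = H.hodgeNumber (-p) (-q) := by
  by_cases hpq : p + q = -n
  · have key := H.hodgeNumber_add_finrank_F_succ_sup (a := -p) (b := -q) (by omega)
    rw [show -p + 1 = 1 - p by ring, show -q + 1 = 1 - q by ring] at key
    have hd := Subspace.finrank_add_finrank_dualAnnihilator_eq (H.F (1 - p) ⊔ complexConj (H.F (1 - q)))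
    rw [Module.finrank_baseChange] at hd
    have lhs : H.dual.hodgeNumber p q = finrank ℂ (H.dual.piece p q) := rfl
    rw [lhs, dual_piece H hpq, finrank_comap_dualBaseChange]
    omega
  · rw [hodgeNumber_eq_zero_of_add_ne _ hpq, hodgeNumber_eq_zero_of_add_ne _ (fun h => hpq (by omega))]

end HodgeStructure

/-! ### The mixed case: `h^{p,q}(H^∨) = h^{-p,-q}(H)` -/

namespace MixedHodgeStructure

variable (H : MixedHodgeStructure V)

/-- `grLift` (the transport `π_n⁻¹` from `ℂ ⊗ Gr^W_n` to `V_ℂ`) preserves binary suprema. [folklore] -/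
private theorem grLift_sup (n : ℤ) (S S' : Submodule ℂ (ℂ ⊗[ℚ] grW H.W n)) :
    H.grLift n (S ⊔ S') = H.grLift n S ⊔ H.grLift n S' := by
  rw [sup_eq_iSup S S', grLift_iSup, sup_eq_iSup (H.grLift n S) (H.grLift n S')]
  refine iSup_congr fun b => ?_
  cases b <;> rfl

/-- **`dim_ℂ (ℂ ⊗ Gr^W_n) + dim W_{n-1,ℂ} = dim W_{n,ℂ}`**: the dimension count of the graded piece
`Gr^W_n = W_n / W_{n-1}` of the weight filtration (Cattani et al., Def. 3.2.15; complexified, `π_n`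
onto with kernel `W_{n-1,ℂ}` — the case `S = ⊤` of `finrank_grLift`).
[cite: CattaniElZeinGriffithsLe2014, Def. 3.2.15] -/
theorem finrank_baseChange_grW_add [FiniteDimensional ℚ V] (n : ℤ) :
    finrank ℂ (ℂ ⊗[ℚ] grW H.W n) + finrank ℂ ((H.W (n - 1)).baseChange ℂ) =
      finrank ℂ ((H.W n).baseChange ℂ) := by
  have h := H.finrank_grLift n ⊤
  rw [grLift_top, finrank_top] at h
  exact h.symm

/-- **`dim W_r(H^∨) + dim W_{-r-1}(H) = dim V`** (`W_r(H^∨) = (W_{-r-1} H)^⊥`, Fujiki (1.6.2) a)).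
[cite: Fujiki1980, (1.6.2) a)] -/
theorem finrank_dual_W_add [FiniteDimensional ℚ V] (r : ℤ) :
    finrank ℚ (H.dual.W r) + finrank ℚ (H.W (-r - 1)) = finrank ℚ V := by
  rw [dual_W, add_comm]
  exact Subspace.finrank_add_finrank_dualAnnihilator_eq _

/-- **The Hodge pieces of `Gr^W(H^∨)`, lifted**: the preimage in `(V_ℂ)^∨` (pulled back to `ℂ ⊗ V^∨`)
of the Hodge piece `(Gr^W_{p+q} H^∨)^{p,q}` is the annihilator of the preimage in `V_ℂ` of
`F^{1-p} Gr^W_m H + conj F^{1-q} Gr^W_m H`, `m = -p-q` — the lattice form of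
`Gr^W_{p+q}(H^∨) = (Gr^W_{-p-q} H)^∨` (El Zein 1983, §II.0.2, for the dual filtration of Deligne,
Hodge II, 1.1.7 / Fujiki (1.6.2) a)) combined with `(A^∨)^{p,q} = (F^{1-p} A + conj F^{1-q} A)^⊥`
(`HodgeStructure.dual_piece`).  Proof: annihilator duality exchanges `⊓` and `⊔`, and the modular
law `(F + W_{m-1}) ∩ W_m = (F ∩ W_m) + W_{m-1}`. [cite: Elzein1983, §II.0.2] -/
theorem dual_hodgePreimage [FiniteDimensional ℚ V] (p q : ℤ) :
    H.dual.hodgePreimage p q =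
      ((H.grLift (-p + -q)
          ((H.gr (-p + -q)).F (1 - p) ⊔ complexConj ((H.gr (-p + -q)).F (1 - q)))).dualAnnihilator).comap
        (dualBaseChange V) := by
  have hAB : (H.W (-p + -q - 1)).baseChange ℂ ≤ (H.W (-p + -q)).baseChange ℂ :=
    Submodule.baseChange_mono ℂ (H.monotone_W (by omega))
  -- modular law, twice
  have e1 : (H.F (1 - p) ⊓ (H.W (-p + -q)).baseChange ℂ) ⊔ (H.W (-p + -q - 1)).baseChange ℂ =
      (H.F (1 - p) ⊔ (H.W (-p + -q - 1)).baseChange ℂ) ⊓ (H.W (-p + -q)).baseChange ℂ := by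
    rw [sup_comm (H.F (1 - p) ⊓ _) _, ← sup_inf_assoc_of_le (H.F (1 - p)) hAB, sup_comm _ (H.F (1 - p))]
  have e2 : (complexConj (H.F (1 - q)) ⊓ (H.W (-p + -q)).baseChange ℂ) ⊔ (H.W (-p + -q - 1)).baseChange ℂ =
      (complexConj (H.F (1 - q)) ⊔ (H.W (-p + -q - 1)).baseChange ℂ) ⊓ (H.W (-p + -q)).baseChange ℂ := by
    rw [sup_comm (complexConj (H.F (1 - q)) ⊓ _) _, ← sup_inf_assoc_of_le (complexConj (H.F (1 - q))) hAB,
      sup_comm _ (complexConj (H.F (1 - q)))]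
  rw [hodgePreimage, baseChange_dual_W, baseChange_dual_W, dual_F, dual_F,
    complexConj_comap_dualAnnihilator, show -(p + q) - 1 = -p + -q - 1 by ring,
    show -(p + q - 1) - 1 = -p + -q by ring, grLift_sup, ← complexConj_grLift, grLift_grF, grLift_grF,
    complexConj_sup, complexConj_inf, complexConj_baseChange, complexConj_baseChange, e1, e2]
  simp only [← Submodule.comap_inf, ← HodgeStructure.comap_dualBaseChange_sup, ← Submodule.dualAnnihilator_sup_eq,
    ← Subspace.dualAnnihilator_inf_eq]

/-- **Hodge numbers of the dual mixed Hodge structure: `h^{p,q}(H^∨) = h^{-p,-q}(H)`** for every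
mixed `ℚ`-Hodge structure `H` on a finite-dimensional `V` and its dual MHS `H^∨`
(`W_r(H^∨) = (W_{-r-1} H)^⊥`, `F^p(H^∨) = (F^{1-p} H)^⊥`, Fujiki (1.6.2) a); Cattani et al. §3.2.2.7):
`Gr^W_r(H^∨) = (Gr^W_{-r} H)^∨` as Hodge structures (El Zein 1983, §II.0.2) and
`h^{p,q}(A^∨) = h^{-p,-q}(A)` for pure `A` (Carlson–Müller-Stach–Peters §1.2), with
`h^{p,q}(H) = h^{p,q}(Gr^W_{p+q} H)` (Cattani et al. §3.2.2.6).  Proved by counting dimensions: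
`dual_hodgePreimage`, `finrank_grLift` (`dim π⁻¹(S) = dim S + dim W_{m-1}`),
`dim U + dim U^⊥ = dim V_ℂ`, and `HodgeStructure.hodgeNumber_add_finrank_F_succ_sup` on `Gr^W_{-p-q} H`.
[cite: CarlsonMullerStachPeters2017, §1.2] [cite: Elzein1983, §II.0.2] -/
theorem hodgeNumber_dual [FiniteDimensional ℚ V] (H : MixedHodgeStructure V) (p q : ℤ) :
    H.dual.hodgeNumber p q = H.hodgeNumber (-p) (-q) := by
  obtain ⟨X, hX⟩ : ∃ X : Submodule ℂ (ℂ ⊗[ℚ] grW H.W (-p + -q)),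
      X = (H.gr (-p + -q)).F (1 - p) ⊔ complexConj ((H.gr (-p + -q)).F (1 - q)) := ⟨_, rfl⟩
  -- `h^{p,q}(H^∨) + dim W_{p+q-1}(H^∨)_ℂ = dim π⁻¹((Gr^W_{p+q} H^∨)^{p,q}) = dim (π⁻¹ X)^⊥`
  have h1 := H.dual.finrank_grLift (p + q) ((H.dual.gr (p + q)).piece p (p + q - p))
  rw [H.dual.grLift_piece (p + q) p, show p + q - p = q by ring, dual_hodgePreimage, ← hX,
    HodgeStructure.finrank_comap_dualBaseChange, baseChange_dual_W,
    show -(p + q - 1) - 1 = -p + -q by ring, HodgeStructure.finrank_comap_dualBaseChange] at h1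
  have h2 := Subspace.finrank_add_finrank_dualAnnihilator_eq (H.grLift (-p + -q) X)
  have h3 := Subspace.finrank_add_finrank_dualAnnihilator_eq ((H.W (-p + -q)).baseChange ℂ)
  have h4 := H.finrank_grLift (-p + -q) X
  have h5 := H.finrank_baseChange_grW_add (-p + -q)
  rw [Module.finrank_baseChange] at h5
  -- the pure identity on `Gr^W_{-p-q} H`
  have h6 := (H.gr (-p + -q)).hodgeNumber_add_finrank_F_succ_sup (a := -p) (b := -q) rfl
  rw [show -p + 1 = 1 - p by ring, show -q + 1 = 1 - q by ring, ← hX] at h6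
  show finrank ℂ ((H.dual.gr (p + q)).piece p q) = (H.gr (-p + -q)).hodgeNumber (-p) (-q)
  omega

/-- `h^{p,q}(H^∨∨) = h^{p,q}(H)`. [cite: CarlsonMullerStachPeters2017, §1.2] -/
theorem hodgeNumber_dual_dual [FiniteDimensional ℚ V] (H : MixedHodgeStructure V) (p q : ℤ) :
    H.dual.dual.hodgeNumber p q = H.hodgeNumber p q := by
  rw [hodgeNumber_dual, hodgeNumber_dual, neg_neg, neg_neg]

/-- **The weights of `H^∨` are the negatives of the weights of `H`**: `Gr^W_k(H^∨) ≠ 0` iff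
`Gr^W_{-k} H ≠ 0` (`W_k(H^∨)/W_{k-1}(H^∨) = (W_{-k})^⊥/(W_{-k-1})^⊥... = (W_{-k-1})^⊥/(W_{-k})^⊥`,
and `U ↦ U^⊥` reverses strict inclusions). [cite: Fujiki1980, (1.6.2) a)] -/
theorem isWeight_dual_iff [FiniteDimensional ℚ V] (H : MixedHodgeStructure V) (k : ℤ) :
    H.dual.IsWeight k ↔ H.IsWeight (-k) := by
  simp only [IsWeight, dual_W, show -(k - 1) - 1 = -k by ring, lt_iff_le_not_ge,
    Subspace.dualAnnihilator_le_dualAnnihilator_iff]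

/-- **`H^∨` is pure of weight `-n` iff `H` is pure of weight `n`** (`W_k(H^∨) = (W_{-k-1} H)^⊥` is `0`,
resp. everything, iff `W_{-k-1} H` is everything, resp. `0`). [cite: Fujiki1980, (1.6.2) a)] -/
theorem isPure_dual_iff [FiniteDimensional ℚ V] (H : MixedHodgeStructure V) (n : ℤ) :
    H.dual.IsPure (-n) ↔ H.IsPure n := by
  simp only [IsPure, dual_W, Submodule.dualAnnihilator_eq_bot_iff, Submodule.dualAnnihilator_eq_top_iff]
  constructor
  · rintro ⟨hlt, hle⟩
    refine ⟨fun k hk => ?_, fun k hk => ?_⟩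
    · have := hle (-k - 1) (by omega)
      rwa [show -(-k - 1) - 1 = k by ring] at this
    · have := hlt (-k - 1) (by omega)
      rwa [show -(-k - 1) - 1 = k by ring] at this
  · rintro ⟨hlt, hle⟩
    exact ⟨fun k hk => hle (-k - 1) (by omega), fun k hk => hlt (-k - 1) (by omega)⟩

end MixedHodgeStructure

end Literature.AlgebraicGeometry.Motives

end
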